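import Summits.Ventures.CertifiedArithmetic.LowPrec.GemmThetaLawGenMixBCheck1
import Summits.Ventures.CertifiedArithmetic.LowPrec.GemmThetaLawGenMixBCheck2
import Summits.Ventures.CertifiedArithmetic.LowPrec.GemmThetaLawGenMixBCheck3
import Summits.Ventures.CertifiedArithmetic.LowPrec.GemmThetaLawGenMixBCheck4
import Summits.Ventures.CertifiedArithmetic.LowPrec.GemmThetaLawGenMixBCheck5
import Summits.Ventures.CertifiedArithmetic.LowPrec.GemmThetaLawGenMixBCheck6

/-!
# The E3M2×E2M1 mixed law check passes for every `p ≥ 13`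

HONEST FRAMING (venture CertifiedArithmetic / cell `pub-lowprec`, seat gemm, gen 12 → 13): certified
error envelopes and provably optimal rounding/accumulation schemes for low-precision formats under
stated cost models; every table by two implementations; no hardware or vendor claims.

`lawCheck_e3m2e2m1`: the letter-dependent symbolic θ-certificate check of the E3M2×E2M1 law
(`GemmThetaLawGenMixBData.e3m2e2m1Law`: `J = 12`, `θ_p = 65·2^(p-10) + 1/4`, `ρ = 7/2`,
`β_pair = 23/2`) passes — all 15,042 classes, their pair tables and all coverage chains — assembled
from the fifteen per-level kernel theorems; it becomes the SUP side of t:thetapmix (E3M2×E2M1 row)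
for every `p ≥ 13` once the soundness layer of `GemmThetaLawGenDefs` lands (gen 13). [cell]
-/

namespace Literature.ComputerArithmetic.FloatingPoint

namespace MiniFloat

namespace ThetaLaw

/-- The levels of the E3M2×E2M1 law, explicitly. [cell] -/
theorem levels_e3m2e2m1 : e3m2e2m1Law.levels =
    [Lev.Q, Lev.bin 0, Lev.bin 1, Lev.bin 2, Lev.bin 3, Lev.bin 4, Lev.bin 5, Lev.bin 6, Lev.bin 7,
      Lev.bin 8, Lev.bin 9, Lev.bin 10, Lev.bin 11, Lev.bin 12, Lev.top] := by
  decide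

/-- THE E3M2×E2M1 LAW CHECK PASSES for every `p ≥ 13`. [cell, kernel; assembled] -/
theorem lawCheck_e3m2e2m1 : e3m2e2m1Law.lawCheck = true := by
  unfold LawData.lawCheck
  rw [levels_e3m2e2m1, sideOK_e3m2e2m1]
  simp only [List.all_cons, List.all_nil, levCheck_e3m2e2m1_Q, levCheck_e3m2e2m1_b0,
    levCheck_e3m2e2m1_b1, levCheck_e3m2e2m1_b2, levCheck_e3m2e2m1_b3, levCheck_e3m2e2m1_b4,
    levCheck_e3m2e2m1_b5, levCheck_e3m2e2m1_b6, levCheck_e3m2e2m1_b7, levCheck_e3m2e2m1_b8,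
    levCheck_e3m2e2m1_b9, levCheck_e3m2e2m1_b10, levCheck_e3m2e2m1_b11, levCheck_e3m2e2m1_b12,
    levCheck_e3m2e2m1_top, Bool.and_self]

end ThetaLaw

end MiniFloat

end Literature.ComputerArithmetic.FloatingPoint
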